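import Summits.NavierStokesRegularity.FunctionalMining.StretchingLaminateBurkholderTree
import Mathlib.Tactic.Linarith
import HarnessLib

/-!
# FunctionalMining — K1-Q1 laminates, L-CAP-B kernel port (5): the dual assembly `LeafClaimB → RatioBound θ` given `(TB)`

search for candidate a priori estimates; no regularity claim.

Cell `pub-nsfunc` (host summit NavierStokesRegularity, topic `FunctionalMining`), prove seat gen 7.  Part of the
kernel port of the bank seat's THEOREM L-CAP-B (`HOME/pub-nsfunc-bank/K1Q1-LAMINATE-BURKHOLDER.md` §1–§3, §7–§8; dict typing
notes 134/134a; numbering of the port: (1) Defs, (2) Limit, (3) Tree, (4) = the three certificate files CertE/CertF0/CertF1,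
(5) Leaf, (6) Faces, then CaseA1/A2 and Cap): `Burkholder1991_keyFunction → C_lam ≤ 49/50`, a cap on the laminate METHOD for the stretching constant
(`C_lam = laminateSupConst`), CONDITIONAL on the vendored Literature named fact `Burkholder1991_keyFunction` (Burkholder 1991,
LNM 1464, §8: the key function `u_λ` of Thm 8.1; only its CONCAVITY clause is used, always as an explicit hypothesis `hBK`).
Nothing in this file is a statement about Navier–Stokes solutions, and `C⋆ = stretchingSupConst` is not touched.

THIS FILE — the kernel form of bank §3 'CONSEQUENCE': summing the typed per-leaf inequality `LeafClaimB θ a b c λ c`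
(file `…BurkholderDefs`) down a valid tree (`Tree.leafClaimB_sum`, pattern of (au) `leafClaim6_sum` with the `u`-terms summed as
`leafSumR (burkNode λ_k M)`), the `a`-terms vanish by isometry (I1), the `b`-terms by the laminate Betchov identity (I2),
the `c`-term is `≤ 0` by the sextic moment (T6), and each `c_k`-term is `≤ 0` by `(TB)` (`…BurkholderTree`):
**`Burkholder1991_keyFunction → LeafClaimB θ a b c λ c → (c ≥ 0, c_k ≥ 0, λ_k > 2) → RatioBound θ`**
(`ratioBound_of_leafClaimB`), hence `laminateSupConst ≤ θ`.
-/

noncomputable section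

namespace Summit.NavierStokesRegularity.FunctionalMining

namespace Laminate

open Burk Literature.Probability.Process Finset

namespace Tree

/-- Bookkeeping: the weighted `u`-terms distribute over a weight. [ours; bookkeeping] -/
private theorem sum_leaf_aux {n : ℕ} (lam cs : Fin n → ℝ) (M W : ℝ) (G : Grad) :
    ∑ k, cs k * (W * burkNode (lam k) M G - abar (lam k) * (W * 1))
      = W * ∑ k, cs k * (burkNode (lam k) M G - abar (lam k)) := by
  rw [Finset.mul_sum]
  exact Finset.sum_congr rfl fun k _ => by ring

/-- Bookkeeping: the weighted `u`-terms are additive over the two children. [ours; bookkeeping] -/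
private theorem sum_node_aux {n : ℕ} (lam cs : Fin n → ℝ) (A B : Fin n → ℝ) (e f : ℝ) :
    ∑ k, cs k * ((A k + B k) - abar (lam k) * (e + f))
      = ∑ k, cs k * (A k - abar (lam k) * e) + ∑ k, cs k * (B k - abar (lam k) * f) := by
  rw [← Finset.sum_add_distrib]
  exact Finset.sum_congr rfl fun k _ => by ring

/-- **Summing the Burkholder leaf claim down a valid tree** (pattern of (au) `leafClaim6_sum`, plus the `u`-terms summed as
`leafSumR (burkNode λ_k M)`). [ours; elementary] -/
theorem leafClaimB_sum {θ a b c : ℝ} {n : ℕ} {lam cs : Fin n → ℝ} (h : LeafClaimB θ a b c lam cs) {M : ℝ}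
    (hM : 0 < M) {V : ℚ} (hV : ((V : ℚ) : ℝ) = M ^ 2) (T : Tree) (hT : T.valid = true) :
    ∀ (G : Grad) (W : ℚ), G.trace = 0 → 0 ≤ W → T.vortSupFrom G ≤ V →
      (1 - 3 / 4 * b) * (T.leafSum Grad.stretch G W : ℝ)
        ≤ θ * M * (T.leafSum Grad.sSq G W : ℝ)
          + a * M * ((T.leafSum Grad.sSq G W : ℝ) - (T.leafSum Grad.vortSq G W : ℝ) / 2)
          + b * (T.leafSum Grad.symCubeTrace G W : ℝ)
          + c / M ^ 3 * ((T.leafSum (Grad.sexticU V) G W : ℝ)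
              - 1178 * M ^ 6 * (T.leafSum (fun _ => 1) G W : ℝ))
          + M ^ 3 * ∑ k, cs k * (T.leafSumR (burkNode (lam k) M) G W
              - abar (lam k) * (T.leafSum (fun _ => 1) G W : ℝ)) := by
  induction T with
  | leaf =>
      intro G W htr hW hsup
      have hv : (G.vortSq : ℝ) ≤ M ^ 2 := by
        rw [← hV]; exact_mod_cast (show G.vortSq ≤ V by simpa [vortSupFrom] using hsup)
      have hW' : (0 : ℝ) ≤ (W : ℝ) := by exact_mod_cast hW
      have hl := mul_le_mul_of_nonneg_left (h G M hM htr hv) hW'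
      simp only [leafSum, leafSumR, Grad.sexticU]
      push_cast
      rw [sum_leaf_aux, hV]
      nlinarith [hl]
  | node s p m ihp ihm =>
      intro G W htr hW hsup
      obtain ⟨h0, h1, hdot, hp, hm⟩ := valid_node hT
      have htrP : (G.layer (1 - s.lam) s).trace = 0 := by rw [Grad.trace_layer, htr, hdot]; ring
      have htrM : (G.layer (-s.lam) s).trace = 0 := by rw [Grad.trace_layer, htr, hdot]; ring
      have hc := vortSupFrom_children s p m G
      have hP := ihp hp _ (W * s.lam) htrP (mul_nonneg hW h0.le) (hc.1.trans hsup)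
      have hM' := ihm hm _ (W * (1 - s.lam)) htrM (mul_nonneg hW (by linarith)) (hc.2.trans hsup)
      simp only [leafSum, leafSumR]
      push_cast
      rw [sum_node_aux]
      linarith

end Tree

/-- **THE BURKHOLDER DUAL ASSEMBLY (kernel form of bank THEOREM L-CAP-B, §3 'CONSEQUENCE')**: a pointwise Burkholder leaf
certificate with `c ≥ 0`, `c_k ≥ 0`, `λ_k > 2` bounds the laminate ratio, GIVEN the Burkholder named fact:
`Burkholder1991_keyFunction → LeafClaimB θ a b c λ c_k → RatioBound θ`.  Proof = (au) `ratioBound_of_leafClaim6`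
(`Σ W|S_L|² = E`, isometry (I1), Betchov (I2), sextic moment (T6), `Σ W = 1`) plus `(TB)` `Σ_L W_L u_{λ_k}(leaf) ≤ ᾱ_{λ_k}`
for each threshold. [ours; conditional on `Burkholder1991_keyFunction`] -/
theorem ratioBound_of_leafClaimB (hBK : Burkholder1991_keyFunction) {θ a b c : ℝ} {n : ℕ} {lam cs : Fin n → ℝ}
    (h : LeafClaimB θ a b c lam cs) (hc : 0 ≤ c) (hcs : ∀ k, 0 ≤ cs k) (hlam : ∀ k, 2 < lam k) :
    RatioBound θ := by
  intro T hT
  have hV0 : 0 ≤ T.vortSup := Tree.vortSup_nonneg T hT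
  by_cases hz : T.vortSup = 0
  · have hsup : (T.vortSup : ℝ) ≤ (0 : ℝ) ^ 2 := by rw [hz]; simp
    have hh := Tree.abs_sigma_le_holder T hT le_rfl hsup
    have hs : (T.sigma : ℝ) ≤ 0 := by
      have := (abs_le.mp hh).2; simpa using this
    have : Real.sqrt (T.vortSup : ℝ) = 0 := by rw [hz]; simp
    rw [this]; linarith
  · have hVpos : 0 < T.vortSup := lt_of_le_of_ne hV0 (Ne.symm hz)
    set M : ℝ := Real.sqrt (T.vortSup : ℝ) with hMdef
    have hM : 0 < M := Real.sqrt_pos.mpr (by exact_mod_cast hVpos)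
    have hV : ((T.vortSup : ℚ) : ℝ) = M ^ 2 := by
      rw [hMdef, Real.sq_sqrt (by exact_mod_cast hV0)]
    have hsum := Tree.leafClaimB_sum h hM hV T hT Grad.zero 1 Grad.trace_zero zero_le_one
      (show T.vortSupFrom Grad.zero ≤ T.vortSup from le_rfl)
    have e1 : T.energy = T.leafSum Grad.sSq Grad.zero 1 := Tree.energy_eq_leafSum_sSq T hT
    have e2 := Tree.leafSum_sSq_sub_half_vortSq T hT Grad.zero 1
    rw [Grad.trSq_zero, mul_zero] at e2
    have e3 := Tree.betchov T hT
    have e4 := Tree.sextic_moment T hT (le_refl T.vortSup)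
    have e5 := Tree.leafSum_one T Grad.zero 1
    have e6 : T.sigma = T.leafSum Grad.stretch Grad.zero 1 := by
      simp only [Tree.sigma, Tree.stretchFrom_eq_leafSum]
    have e1' : (T.energy : ℝ) = (T.leafSum Grad.sSq Grad.zero 1 : ℝ) := by exact_mod_cast e1
    have e2' : (T.leafSum Grad.sSq Grad.zero 1 : ℝ) - (T.leafSum Grad.vortSq Grad.zero 1 : ℝ) / 2 = 0 := by
      exact_mod_cast e2
    have e3q : T.leafSum Grad.symCubeTrace Grad.zero 1 = -(3 / 4) * T.sigma := by linarith [e3]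
    have e3' : (T.leafSum Grad.symCubeTrace Grad.zero 1 : ℝ) = -(3 / 4) * (T.sigma : ℝ) := by
      rw [e3q]; push_cast; ring
    have e4' : (T.leafSum (Grad.sexticU T.vortSup) Grad.zero 1 : ℝ) ≤ 1178 * M ^ 6 := by
      have h4 : ((T.leafSum (Grad.sexticU T.vortSup) Grad.zero 1 : ℚ) : ℝ)
          ≤ ((1178 * T.vortSup ^ 3 : ℚ) : ℝ) := by
        exact_mod_cast e4
      push_cast at h4
      rw [hV] at h4
      calc (T.leafSum (Grad.sexticU T.vortSup) Grad.zero 1 : ℝ) ≤ 1178 * (M ^ 2) ^ 3 := h4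
        _ = 1178 * M ^ 6 := by ring
    have e5' : (T.leafSum (fun _ => (1 : ℚ)) Grad.zero 1 : ℝ) = 1 := by exact_mod_cast e5
    have e6' : (T.sigma : ℝ) = (T.leafSum Grad.stretch Grad.zero 1 : ℝ) := by exact_mod_cast e6
    have hcM : 0 ≤ c / M ^ 3 := div_nonneg hc (pow_nonneg hM.le 3)
    have hlast : c / M ^ 3 * ((T.leafSum (Grad.sexticU T.vortSup) Grad.zero 1 : ℝ)
        - 1178 * M ^ 6 * (T.leafSum (fun _ => (1 : ℚ)) Grad.zero 1 : ℝ)) ≤ 0 := by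
      rw [e5', mul_one]
      have := mul_nonneg hcM (show (0 : ℝ) ≤ 1178 * M ^ 6 - (T.leafSum (Grad.sexticU T.vortSup) Grad.zero 1 : ℝ)
        by linarith)
      linarith
    -- the Burkholder terms: each `Σ_L W_L u_k(leaf) − ᾱ_k ≤ 0` by (TB)
    have hTB : M ^ 3 * ∑ k, cs k * (T.leafSumR (burkNode (lam k) M) Grad.zero 1
        - abar (lam k) * (T.leafSum (fun _ => (1 : ℚ)) Grad.zero 1 : ℝ)) ≤ 0 := by
      have hs : ∑ k, cs k * (T.leafSumR (burkNode (lam k) M) Grad.zero 1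
          - abar (lam k) * (T.leafSum (fun _ => (1 : ℚ)) Grad.zero 1 : ℝ)) ≤ 0 := by
        apply Finset.sum_nonpos
        intro k _
        have htb := Tree.leafSumR_burkNode_root_le hBK (hlam k) hM hV T hT le_rfl
        rw [e5', mul_one]
        exact mul_nonpos_of_nonneg_of_nonpos (hcs k) (by linarith)
      exact mul_nonpos_of_nonneg_of_nonpos (pow_nonneg hM.le 3) hs
    rw [e2', e3', ← e1', ← e6'] at hsum
    linarith [hsum, hlast, hTB]

/-- `Burkholder1991_keyFunction → LeafClaimB θ a b c λ c → … → laminateSupConst ≤ θ`. [ours; conditional] -/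
theorem laminateSupConst_le_of_leafClaimB (hBK : Burkholder1991_keyFunction) {θ a b c : ℝ} {n : ℕ}
    {lam cs : Fin n → ℝ} (h : LeafClaimB θ a b c lam cs) (hc : 0 ≤ c) (hcs : ∀ k, 0 ≤ cs k)
    (hlam : ∀ k, 2 < lam k) : laminateSupConst ≤ θ :=
  laminateSupConst_le_of_ratioBound (ratioBound_of_leafClaimB hBK h hc hcs hlam)

end Laminate

end Summit.NavierStokesRegularity.FunctionalMining

end
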